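import Summits.AtomisticToContinuum.Crystallization.Theorems.SquareWellLayerCakeGapTwelveToBarlowFiveFoldFarDisjointPlanar
import Summits.AtomisticToContinuum.Crystallization.Theorems.HullExactificationCascadeZeroDefectDensityLinkLemmaAux
import HarnessLib

/-!
# Link lemma for the birth line — part 2/2: the link of a shell vertex seen from the centre
# (route `HullExactificationCascade`, crux `ZeroDefectDensity`, stmt-AtomisticToContinuum-12086; line `birth`,
# stub `stub_linkLemma`, registered signature verbatim)

`p` is the centre of a softly twelve-kissed shell, `c` one of its neighbours and `n₁, …, n₄` the
four common soft contacts of `p` and `c` (soft contact = distance in `[1 - η, 1 + η]`,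
`η ≤ 1/1000`; non-contacts are `≥ 131/100`).  Type A (contacts `n₁n₂`, `n₃n₄`): one of the two
diagonal pairs `{13, 24}`, `{23, 41}` consists of chords `≥ 17/10`; type B (contacts `n₁n₂`,
`n₂n₃`): `|n₁n₃| ≥ 8/5` and `|n₂n₄| ≥ 17/10`.

Proof.  Put `a = p - c`, `bᵢ = nᵢ - c`; all of `‖a‖, ‖bᵢ‖, ‖a - bᵢ‖` lie in the band, so
`αᵢ = ⟪bᵢ, a/‖a‖⟫ ∈ [0.497, 0.503]` (`link_point`).  In the planar frame of the unit axis `a/‖a‖`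
(`exists_planar_frame`, landed) every vector `q` has planar coordinates with
`⟪q, q'⟫ = ρ_q ρ_{q'} ⟪e_q, e_{q'}⟫ + α_q α_{q'}`, `e_q` a unit vector of the plane and
`ρ_q² = ‖q‖² - α_q²` (`link_frame`); for the `bᵢ`, `ρᵢ² ∈ [0.7449, 0.755]`, a soft contact has
`0 ≤ ⟪eᵢ, eⱼ⟫ ≤ 0.344` and a non-contact `⟪eᵢ, eⱼ⟫ ≤ -0.136` (`link_vcontact`, `link_vfar`).  The
planar lemmas of part 1 (`link_planarA`, `link_planarB`) give `⟪eᵢ, eⱼ⟫ ≤ -0.975` (resp. `≤ -0.763`),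
whence `⟪bᵢ, bⱼ⟫ ≤ -0.473` (resp. `≤ -0.315`) and `‖bᵢ - bⱼ‖ ≥ 17/10` (resp. `≥ 8/5`)
(`link_vback`).

Mathlib + the landed planar frame + part 1; no named fact is used.
-/

noncomputable section

namespace Summit.AtomisticToContinuum.Crystallization.Theorems.ZeroDefectDensityBirth

open scoped InnerProductSpace
open Summit.AtomisticToContinuum.Crystallization.Theorems.SquareWellLayerCakeGapTwelveToBarlow
  (exists_planar_frame)

/-! ## Scalar bookkeeping -/

/-- A length in the band `[1 - η, 1 + η]`, `0 ≤ η ≤ 1/1000`, and its square. [folklore] -/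
theorem link_band {η B : ℝ} (hη0 : 0 ≤ η) (hη : η ≤ 1 / 1000) (h1 : 1 - η ≤ B)
    (h2 : B ≤ 1 + η) : 0.999 ≤ B ∧ B ≤ 1.001 ∧ 0.998001 ≤ B ^ 2 ∧ B ^ 2 ≤ 1.002001 := by
  have h3 : 0.999 ≤ B := by linarith
  have h4 : B ≤ 1.001 := by linarith
  exact ⟨h3, h4, by nlinarith, by nlinarith⟩

/-- Axis component `α = ⟪b, a⟫/‖a‖` and squared planar radius `R = ‖b‖² - α²` of a band point:
`α ∈ [0.497, 0.503]`, `R ∈ [0.7449, 0.755]`. [folklore] -/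
theorem link_point {A B D α R : ℝ} (hA : 0.999 ≤ A) (hA' : A ≤ 1.001) (hB : 0.998001 ≤ B ^ 2)
    (hB' : B ^ 2 ≤ 1.002001) (hD : 0.998001 ≤ D ^ 2) (hD' : D ^ 2 ≤ 1.002001)
    (hα : α * A = (B ^ 2 + A ^ 2 - D ^ 2) / 2) (hR : R = B ^ 2 - α ^ 2) :
    0.497 ≤ α ∧ α ≤ 0.503 ∧ 0.7449 ≤ R ∧ R ≤ 0.755 := by
  have hαU : α ≤ 0.503 := by
    by_contra h
    nlinarith [mul_lt_mul_of_pos_right (not_le.mp h) (by linarith : (0 : ℝ) < A),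
      mul_nonneg (by linarith : 0 ≤ A - 0.999) (by linarith : 0 ≤ 1.001 - A)]
  have hαL : 0.497 ≤ α := by
    by_contra h
    nlinarith [mul_lt_mul_of_pos_right (not_le.mp h) (by linarith : (0 : ℝ) < A),
      mul_nonneg (by linarith : 0 ≤ A - 0.999) (by linarith : 0 ≤ A)]
  refine ⟨hαL, hαU, ?_, ?_⟩
  · rw [hR]
    nlinarith [mul_le_mul hαU hαU (by linarith) (by norm_num : (0 : ℝ) ≤ 0.503)]
  · rw [hR]
    nlinarith [mul_le_mul hαL hαL (by norm_num) (by linarith : 0 ≤ α)]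

/-- Product of two planar radii. [folklore] -/
theorem link_prod {ρ₁ ρ₂ : ℝ} (h₁ : 0 < ρ₁) (h₂ : 0 < ρ₂) (h₁l : 0.7449 ≤ ρ₁ ^ 2)
    (h₁u : ρ₁ ^ 2 ≤ 0.755) (h₂l : 0.7449 ≤ ρ₂ ^ 2) (h₂u : ρ₂ ^ 2 ≤ 0.755) :
    0.7449 ≤ ρ₁ * ρ₂ ∧ ρ₁ * ρ₂ ≤ 0.755 := by
  have hP : 0 < ρ₁ * ρ₂ := mul_pos h₁ h₂
  constructor
  · by_contra h
    have h' := not_le.mp h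
    nlinarith [mul_le_mul h₁l h₂l (by norm_num) (by linarith), mul_lt_mul'' h' h' hP.le hP.le]
  · by_contra h
    have h' := not_le.mp h
    nlinarith [mul_le_mul h₁u h₂u (by linarith) (by norm_num : (0 : ℝ) ≤ 0.755),
      mul_lt_mul'' h' h' (by norm_num) (by norm_num)]

/-- Inner product of a soft contact pair from the three band lengths. [folklore] -/
theorem link_gContact {g B₁ B₂ D : ℝ} (hD : D ^ 2 = B₁ ^ 2 - 2 * g + B₂ ^ 2)
    (hB₁ : 0.998001 ≤ B₁ ^ 2) (hB₁' : B₁ ^ 2 ≤ 1.002001) (hB₂ : 0.998001 ≤ B₂ ^ 2)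
    (hB₂' : B₂ ^ 2 ≤ 1.002001) (hD1 : 0.998001 ≤ D ^ 2) (hD2 : D ^ 2 ≤ 1.002001) :
    0.4970005 ≤ g ∧ g ≤ 0.5030005 := by
  constructor <;> linarith

/-- Inner product of a non-contact pair (`≥ 131/100` apart). [folklore] -/
theorem link_gFar {g B₁ B₂ D : ℝ} (hD : D ^ 2 = B₁ ^ 2 - 2 * g + B₂ ^ 2)
    (hB₁' : B₁ ^ 2 ≤ 1.002001) (hB₂' : B₂ ^ 2 ≤ 1.002001) (hD1 : 131 / 100 ≤ D) :
    g ≤ 0.143951 := by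
  nlinarith [mul_le_mul hD1 hD1 (by norm_num) (by linarith)]

/-- A chord lower bound from an inner product upper bound. [folklore] -/
theorem link_distOfG {g B₁ B₂ D s : ℝ} (hD : D ^ 2 = B₁ ^ 2 - 2 * g + B₂ ^ 2)
    (hB₁ : 0.998001 ≤ B₁ ^ 2) (hB₂ : 0.998001 ≤ B₂ ^ 2) (hD0 : 0 ≤ D)
    (hg : s ^ 2 ≤ 1.996002 - 2 * g) : s ≤ D := by
  by_contra h
  nlinarith [mul_self_lt_mul_self hD0 (not_le.mp h)]

/-- Planar inner product of a soft contact pair: with `g = ⟪bᵢ, bⱼ⟫ = P · D + αᵢ αⱼ`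
(`P = ρᵢ ρⱼ`), `0 ≤ D ≤ 0.344`. [folklore] -/
theorem link_pairContact {g P Dd α₁ α₂ : ℝ} (hg : g = P * Dd + α₁ * α₂) (hP : 0.7449 ≤ P)
    (h₁ : 0.497 ≤ α₁) (h₁' : α₁ ≤ 0.503) (h₂ : 0.497 ≤ α₂) (h₂' : α₂ ≤ 0.503)
    (hg1 : 0.4970005 ≤ g) (hg2 : g ≤ 0.5030005) : 0 ≤ Dd ∧ Dd ≤ 0.344 := by
  have hαα : α₁ * α₂ ≤ 0.253009 := by
    nlinarith [mul_le_mul h₁' h₂' (by linarith) (by norm_num : (0 : ℝ) ≤ 0.503)]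
  have hαα' : 0.247009 ≤ α₁ * α₂ := by
    nlinarith [mul_le_mul h₁ h₂ (by norm_num) (by linarith : 0 ≤ α₁)]
  constructor
  · by_contra h
    nlinarith [mul_lt_mul_of_pos_left (not_le.mp h) (by linarith : 0 < P)]
  · by_contra h
    nlinarith [mul_lt_mul_of_pos_left (not_le.mp h) (by linarith : 0 < P)]

/-- Planar inner product of a non-contact pair: `D ≤ -0.136`. [folklore] -/
theorem link_pairFar {g P Dd α₁ α₂ : ℝ} (hg : g = P * Dd + α₁ * α₂) (hP : 0.7449 ≤ P)
    (hP' : P ≤ 0.755) (h₁ : 0.497 ≤ α₁) (h₂ : 0.497 ≤ α₂) (hg2 : g ≤ 0.143951) :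
    Dd ≤ -0.136 := by
  have hαα' : 0.247009 ≤ α₁ * α₂ := by
    nlinarith [mul_le_mul h₁ h₂ (by norm_num) (by linarith : 0 ≤ α₁)]
  by_contra h
  nlinarith [mul_lt_mul_of_pos_left (not_le.mp h) (by linarith : 0 < P)]

/-- Back from the plane: `D ≤ -ν` (`ν ≥ 0`) gives `g ≤ -0.7449 ν + 0.253009`. [folklore] -/
theorem link_pairBack {g P Dd α₁ α₂ ν : ℝ} (hg : g = P * Dd + α₁ * α₂) (hP : 0.7449 ≤ P)
    (h₁' : α₁ ≤ 0.503) (h₂ : 0.497 ≤ α₂) (h₂' : α₂ ≤ 0.503) (hν : 0 ≤ ν) (hD : Dd ≤ -ν) :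
    g ≤ -(0.7449 * ν) + 0.253009 := by
  have hαα : α₁ * α₂ ≤ 0.253009 := by
    nlinarith [mul_le_mul h₁' h₂' (by linarith) (by norm_num : (0 : ℝ) ≤ 0.503)]
  nlinarith [mul_le_mul hP (by linarith : ν ≤ -Dd) hν (by linarith)]

/-! ## The planar frame about the axis `a = p - c` -/

/-- **Planar frame with polar data.**  For `a ≠ 0` there are functions `x, y, ρ, α` on `ℝ³`
with `α q ‖a‖ = ⟪q, a⟫`, `ρ q ≥ 0`, `ρ q² = ‖q‖² - (α q)²`, `(x q, y q)` a unit vector whenever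
`ρ q > 0`, and `⟪q, q'⟫ = ρ q ρ q' (x q x q' + y q y q') + α q α q'` (for `ρ q, ρ q' > 0`):
cylindrical coordinates about the axis `a`, from the landed `exists_planar_frame`. [folklore] -/
theorem link_frame (a : EuclideanSpace ℝ (Fin 3)) (ha : a ≠ 0) :
    ∃ x y ρ α : EuclideanSpace ℝ (Fin 3) → ℝ,
      (∀ q, α q * ‖a‖ = ⟪q, a⟫_ℝ) ∧ (∀ q, 0 ≤ ρ q) ∧ (∀ q, ρ q ^ 2 = ‖q‖ ^ 2 - α q ^ 2) ∧
      (∀ q, 0 < ρ q → x q ^ 2 + y q ^ 2 = 1) ∧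
      ∀ q q', 0 < ρ q → 0 < ρ q' →
        ⟪q, q'⟫_ℝ = ρ q * ρ q' * (x q * x q' + y q * y q') + α q * α q' := by
  have hu : ‖(‖a‖⁻¹ • a : EuclideanSpace ℝ (Fin 3))‖ = 1 := norm_smul_inv_norm ha
  obtain ⟨φ, hφ⟩ := exists_planar_frame _ hu
  have hre : ∀ q q' : EuclideanSpace ℝ (Fin 3), (φ q).re * (φ q').re + (φ q).im * (φ q').im =
      ⟪q, q'⟫_ℝ - ⟪q, ‖a‖⁻¹ • a⟫_ℝ * ⟪q', ‖a‖⁻¹ • a⟫_ℝ := by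
    intro q q'
    rw [← hφ q q', Complex.mul_re, Complex.conj_re, Complex.conj_im]
    ring
  have ha' : ‖a‖ ≠ 0 := norm_ne_zero_iff.mpr ha
  refine ⟨fun q => (φ q).re / √((φ q).re ^ 2 + (φ q).im ^ 2),
    fun q => (φ q).im / √((φ q).re ^ 2 + (φ q).im ^ 2),
    fun q => √((φ q).re ^ 2 + (φ q).im ^ 2), fun q => ⟪q, ‖a‖⁻¹ • a⟫_ℝ, fun q => ?_,
    fun q => Real.sqrt_nonneg _, fun q => ?_, fun q hq => ?_, fun q q' hq hq' => ?_⟩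
  · beta_reduce
    rw [real_inner_smul_right, mul_comm, ← mul_assoc, mul_inv_cancel₀ ha', one_mul]
  · beta_reduce
    rw [Real.sq_sqrt (by positivity), ← real_inner_self_eq_norm_sq]
    linear_combination hre q q
  · beta_reduce at hq ⊢
    have h2 : √((φ q).re ^ 2 + (φ q).im ^ 2) ^ 2 = (φ q).re ^ 2 + (φ q).im ^ 2 :=
      Real.sq_sqrt (by positivity)
    rw [div_pow, div_pow, ← add_div, h2, div_self (by rw [← h2]; positivity)]
  · beta_reduce at hq hq' ⊢
    rw [← sub_eq_iff_eq_add, ← hre q q']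
    field_simp

/-! ## Points and pairs in the frame -/

/-- **A common soft contact in the frame.**  With `a = p - c`, `b = n - c` and band lengths
`|cp|, |cn|, |pn|`: `α b ∈ [0.497, 0.503]`, `(ρ b)² ∈ [0.7449, 0.755]`, `ρ b > 0`,
`‖b‖² ∈ [0.998001, 1.002001]`. [folklore] -/
theorem link_vpoint {η : ℝ} {p c n : EuclideanSpace ℝ (Fin 3)}
    {ρ α : EuclideanSpace ℝ (Fin 3) → ℝ} (hα : ∀ q, α q * ‖p - c‖ = ⟪q, p - c⟫_ℝ)
    (hρ0 : ∀ q, 0 ≤ ρ q) (hρ : ∀ q, ρ q ^ 2 = ‖q‖ ^ 2 - α q ^ 2) (hη0 : 0 ≤ η)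
    (hη : η ≤ 1 / 1000) (hcp : 1 - η ≤ ‖c - p‖) (hcp' : ‖c - p‖ ≤ 1 + η)
    (hpn : 1 - η ≤ ‖p - n‖) (hpn' : ‖p - n‖ ≤ 1 + η) (hcn : 1 - η ≤ ‖c - n‖)
    (hcn' : ‖c - n‖ ≤ 1 + η) :
    0.497 ≤ α (n - c) ∧ α (n - c) ≤ 0.503 ∧ 0.7449 ≤ ρ (n - c) ^ 2 ∧ ρ (n - c) ^ 2 ≤ 0.755 ∧
      0 < ρ (n - c) ∧ 0.998001 ≤ ‖n - c‖ ^ 2 ∧ ‖n - c‖ ^ 2 ≤ 1.002001 := by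
  rw [norm_sub_rev] at hcp hcp' hcn hcn'
  obtain ⟨hA, hA', hA2, hA2'⟩ := link_band hη0 hη hcp hcp'
  obtain ⟨-, -, hB2, hB2'⟩ := link_band hη0 hη hcn hcn'
  obtain ⟨-, -, hD2, hD2'⟩ := link_band hη0 hη hpn hpn'
  have hin : α (n - c) * ‖p - c‖ = (‖n - c‖ ^ 2 + ‖p - c‖ ^ 2 - ‖p - n‖ ^ 2) / 2 := by
    rw [hα, ← sub_sub_sub_cancel_right p n c, norm_sub_rev (p - c), norm_sub_sq_real (n - c) (p - c)]
    ring
  obtain ⟨h1, h2, h3, h4⟩ := link_point hA hA' hB2 hB2' hD2 hD2' hin (hρ (n - c))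
  refine ⟨h1, h2, h3, h4, ?_, hB2, hB2'⟩
  rcases (hρ0 (n - c)).lt_or_eq with h | h
  · exact h
  · rw [← h] at h3
    norm_num at h3

/-- **A soft contact pair in the frame**: `0 ≤ ⟪eᵢ, eⱼ⟫ ≤ 0.344`. [folklore] -/
theorem link_vcontact {η : ℝ} {c n m : EuclideanSpace ℝ (Fin 3)}
    {x y ρ α : EuclideanSpace ℝ (Fin 3) → ℝ}
    (hid : ∀ q q', 0 < ρ q → 0 < ρ q' →
      ⟪q, q'⟫_ℝ = ρ q * ρ q' * (x q * x q' + y q * y q') + α q * α q')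
    (hn : 0.497 ≤ α (n - c) ∧ α (n - c) ≤ 0.503 ∧ 0.7449 ≤ ρ (n - c) ^ 2 ∧
      ρ (n - c) ^ 2 ≤ 0.755 ∧ 0 < ρ (n - c) ∧ 0.998001 ≤ ‖n - c‖ ^ 2 ∧ ‖n - c‖ ^ 2 ≤ 1.002001)
    (hm : 0.497 ≤ α (m - c) ∧ α (m - c) ≤ 0.503 ∧ 0.7449 ≤ ρ (m - c) ^ 2 ∧
      ρ (m - c) ^ 2 ≤ 0.755 ∧ 0 < ρ (m - c) ∧ 0.998001 ≤ ‖m - c‖ ^ 2 ∧ ‖m - c‖ ^ 2 ≤ 1.002001)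
    (hη0 : 0 ≤ η) (hη : η ≤ 1 / 1000) (h1 : 1 - η ≤ ‖n - m‖) (h2 : ‖n - m‖ ≤ 1 + η) :
    0 ≤ x (n - c) * x (m - c) + y (n - c) * y (m - c) ∧
      x (n - c) * x (m - c) + y (n - c) * y (m - c) ≤ 0.344 := by
  obtain ⟨hα1, hα1', hρ1, hρ1', hρ1p, hB1, hB1'⟩ := hn
  obtain ⟨hα2, hα2', hρ2, hρ2', hρ2p, hB2, hB2'⟩ := hm
  rw [← sub_sub_sub_cancel_right n m c] at h1 h2
  obtain ⟨-, -, hD2, hD2'⟩ := link_band hη0 hη h1 h2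
  obtain ⟨hP, -⟩ := link_prod hρ1p hρ2p hρ1 hρ1' hρ2 hρ2'
  obtain ⟨hg1, hg2⟩ := link_gContact (norm_sub_sq_real (n - c) (m - c)) hB1 hB1' hB2 hB2' hD2 hD2'
  exact link_pairContact (hid _ _ hρ1p hρ2p) hP hα1 hα1' hα2 hα2' hg1 hg2

/-- **A non-contact pair in the frame**: `⟪eᵢ, eⱼ⟫ ≤ -0.136`. [folklore] -/
theorem link_vfar {c n m : EuclideanSpace ℝ (Fin 3)} {x y ρ α : EuclideanSpace ℝ (Fin 3) → ℝ}
    (hid : ∀ q q', 0 < ρ q → 0 < ρ q' →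
      ⟪q, q'⟫_ℝ = ρ q * ρ q' * (x q * x q' + y q * y q') + α q * α q')
    (hn : 0.497 ≤ α (n - c) ∧ α (n - c) ≤ 0.503 ∧ 0.7449 ≤ ρ (n - c) ^ 2 ∧
      ρ (n - c) ^ 2 ≤ 0.755 ∧ 0 < ρ (n - c) ∧ 0.998001 ≤ ‖n - c‖ ^ 2 ∧ ‖n - c‖ ^ 2 ≤ 1.002001)
    (hm : 0.497 ≤ α (m - c) ∧ α (m - c) ≤ 0.503 ∧ 0.7449 ≤ ρ (m - c) ^ 2 ∧
      ρ (m - c) ^ 2 ≤ 0.755 ∧ 0 < ρ (m - c) ∧ 0.998001 ≤ ‖m - c‖ ^ 2 ∧ ‖m - c‖ ^ 2 ≤ 1.002001)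
    (h : 131 / 100 ≤ ‖n - m‖) : x (n - c) * x (m - c) + y (n - c) * y (m - c) ≤ -0.136 := by
  obtain ⟨hα1, -, hρ1, hρ1', hρ1p, -, hB1'⟩ := hn
  obtain ⟨hα2, -, hρ2, hρ2', hρ2p, -, hB2'⟩ := hm
  rw [← sub_sub_sub_cancel_right n m c] at h
  obtain ⟨hP, hP'⟩ := link_prod hρ1p hρ2p hρ1 hρ1' hρ2 hρ2'
  exact link_pairFar (hid _ _ hρ1p hρ2p) hP hP' hα1 hα2
    (link_gFar (norm_sub_sq_real (n - c) (m - c)) hB1' hB2' h)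

/-- **Back from the frame**: `⟪eᵢ, eⱼ⟫ ≤ -ν` with `s² ≤ 1.4899 + 1.4898 ν` gives `|n m| ≥ s`
(used with `(ν, s) = (0.975, 17/10)` and `(0.763, 8/5)`). [folklore] -/
theorem link_vback {c n m : EuclideanSpace ℝ (Fin 3)} {x y ρ α : EuclideanSpace ℝ (Fin 3) → ℝ}
    {ν s : ℝ} (hid : ∀ q q', 0 < ρ q → 0 < ρ q' →
      ⟪q, q'⟫_ℝ = ρ q * ρ q' * (x q * x q' + y q * y q') + α q * α q')
    (hn : 0.497 ≤ α (n - c) ∧ α (n - c) ≤ 0.503 ∧ 0.7449 ≤ ρ (n - c) ^ 2 ∧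
      ρ (n - c) ^ 2 ≤ 0.755 ∧ 0 < ρ (n - c) ∧ 0.998001 ≤ ‖n - c‖ ^ 2 ∧ ‖n - c‖ ^ 2 ≤ 1.002001)
    (hm : 0.497 ≤ α (m - c) ∧ α (m - c) ≤ 0.503 ∧ 0.7449 ≤ ρ (m - c) ^ 2 ∧
      ρ (m - c) ^ 2 ≤ 0.755 ∧ 0 < ρ (m - c) ∧ 0.998001 ≤ ‖m - c‖ ^ 2 ∧ ‖m - c‖ ^ 2 ≤ 1.002001)
    (hν : 0 ≤ ν) (hsν : s ^ 2 ≤ 1.4899 + 1.4898 * ν)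
    (h : x (n - c) * x (m - c) + y (n - c) * y (m - c) ≤ -ν) : s ≤ ‖n - m‖ := by
  obtain ⟨-, hα1', hρ1, hρ1', hρ1p, hB1, -⟩ := hn
  obtain ⟨hα2, hα2', hρ2, hρ2', hρ2p, hB2, -⟩ := hm
  rw [← sub_sub_sub_cancel_right n m c]
  obtain ⟨hP, -⟩ := link_prod hρ1p hρ2p hρ1 hρ1' hρ2 hρ2'
  have hg := link_pairBack (hid _ _ hρ1p hρ2p) hP hα1' hα2 hα2' hν h
  exact link_distOfG (norm_sub_sq_real (n - c) (m - c)) hB1 hB2 (norm_nonneg _) (by linarith)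

/-! ## The link lemma -/

/-- **Link lemma, type A** (contacts `n₁n₂`, `n₃n₄`): one of the diagonal pairs `{13, 24}`,
`{23, 41}` consists of chords `≥ 17/10`. [folklore] -/
theorem link_typeA : ∀ (η : ℝ) (p c n₁ n₂ n₃ n₄ : EuclideanSpace ℝ (Fin 3)), 0 ≤ η → η ≤ 1 / 1000 → 1 - η ≤ dist c p → dist c p ≤ 1 + η → 1 - η ≤ dist p n₁ → dist p n₁ ≤ 1 + η → 1 - η ≤ dist p n₂ → dist p n₂ ≤ 1 + η → 1 - η ≤ dist p n₃ → dist p n₃ ≤ 1 + η → 1 - η ≤ dist p n₄ → dist p n₄ ≤ 1 + η → 1 - η ≤ dist c n₁ → dist c n₁ ≤ 1 + η → 1 - η ≤ dist c n₂ → dist c n₂ ≤ 1 + η → 1 - η ≤ dist c n₃ → dist c n₃ ≤ 1 + η → 1 - η ≤ dist c n₄ → dist c n₄ ≤ 1 + η → 1 - η ≤ dist n₁ n₂ → dist n₁ n₂ ≤ 1 + η → 1 - η ≤ dist n₃ n₄ → dist n₃ n₄ ≤ 1 + η → 131 / 100 ≤ dist n₁ n₃ → 131 / 100 ≤ dist n₂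 n₄ → 131 / 100 ≤ dist n₂ n₃ → 131 / 100 ≤ dist n₄ n₁ → (17 / 10 ≤ dist n₁ n₃ ∧ 17 / 10 ≤ dist n₂ n₄) ∨ (17 / 10 ≤ dist n₂ n₃ ∧ 17 / 10 ≤ dist n₄ n₁) := by
  intro η p c n₁ n₂ n₃ n₄ hη0 hη hcp hcp' hp₁ hp₁' hp₂ hp₂' hp₃ hp₃' hp₄ hp₄' hc₁ hc₁' hc₂ hc₂'
    hc₃ hc₃' hc₄ hc₄' h₁₂ h₁₂' h₃₄ h₃₄' f₁₃ f₂₄ f₂₃ f₄₁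
  simp only [dist_eq_norm] at *
  have ha : p - c ≠ 0 := by
    intro h
    rw [norm_sub_rev, h, norm_zero] at hcp
    linarith
  obtain ⟨x, y, ρ, α, hα, hρ0, hρ, hxy, hid⟩ := link_frame (p - c) ha
  have P₁ := link_vpoint hα hρ0 hρ hη0 hη hcp hcp' hp₁ hp₁' hc₁ hc₁'
  have P₂ := link_vpoint hα hρ0 hρ hη0 hη hcp hcp' hp₂ hp₂' hc₂ hc₂'
  have P₃ := link_vpoint hα hρ0 hρ hη0 hη hcp hcp' hp₃ hp₃' hc₃ hc₃'
  have P₄ := link_vpoint hα hρ0 hρ hη0 hη hcp hcp' hp₄ hp₄' hc₄ hc₄'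
  obtain ⟨c₁₂, c₁₂'⟩ := link_vcontact hid P₁ P₂ hη0 hη h₁₂ h₁₂'
  obtain ⟨c₃₄, c₃₄'⟩ := link_vcontact hid P₃ P₄ hη0 hη h₃₄ h₃₄'
  rcases link_planarA (hxy _ P₁.2.2.2.2.1) (hxy _ P₂.2.2.2.2.1) (hxy _ P₃.2.2.2.2.1)
      (hxy _ P₄.2.2.2.2.1) c₁₂ c₁₂' c₃₄ c₃₄' (link_vfar hid P₁ P₃ f₁₃) (link_vfar hid P₂ P₄ f₂₄)
      (link_vfar hid P₂ P₃ f₂₃) (link_vfar hid P₄ P₁ f₄₁) with ⟨e₁₃, e₂₄⟩ | ⟨e₂₃, e₄₁⟩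
  · exact Or.inl ⟨link_vback hid P₁ P₃ (by norm_num) (by norm_num) e₁₃,
      link_vback hid P₂ P₄ (by norm_num) (by norm_num) e₂₄⟩
  · exact Or.inr ⟨link_vback hid P₂ P₃ (by norm_num) (by norm_num) e₂₃,
      link_vback hid P₄ P₁ (by norm_num) (by norm_num) e₄₁⟩

/-- **Link lemma, type B** (contacts `n₁n₂`, `n₂n₃`): `|n₁n₃| ≥ 8/5` and `|n₂n₄| ≥ 17/10`.
[folklore] -/
theorem link_typeB : ∀ (η : ℝ) (p c n₁ n₂ n₃ n₄ : EuclideanSpace ℝ (Fin 3)), 0 ≤ η → η ≤ 1 / 1000 → 1 - η ≤ dist c p → dist c p ≤ 1 + η → 1 - η ≤ dist p n₁ → dist p n₁ ≤ 1 + η → 1 - η ≤ dist p n₂ → dist p n₂ ≤ 1 + η → 1 - η ≤ dist p n₃ → dist p n₃ ≤ 1 + η → 1 - η ≤ dist p n₄ → dist p n₄ ≤ 1 + η → 1 - η ≤ dist c n₁ → dist c n₁ ≤ 1 + η → 1 - η ≤ dist c n₂ → dist c n₂ ≤ 1 + η → 1 - η ≤ dist c n₃ → dist c n₃ ≤ 1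 + η → 1 - η ≤ dist c n₄ → dist c n₄ ≤ 1 + η → 1 - η ≤ dist n₁ n₂ → dist n₁ n₂ ≤ 1 + η → 1 - η ≤ dist n₂ n₃ → dist n₂ n₃ ≤ 1 + η → 131 / 100 ≤ dist n₁ n₃ → 131 / 100 ≤ dist n₂ n₄ → 131 / 100 ≤ dist n₃ n₄ → 131 / 100 ≤ dist n₄ n₁ → 8 / 5 ≤ dist n₁ n₃ ∧ 17 / 10 ≤ dist n₂ n₄ := by
  intro η p c n₁ n₂ n₃ n₄ hη0 hη hcp hcp' hp₁ hp₁' hp₂ hp₂' hp₃ hp₃' hp₄ hp₄' hc₁ hc₁' hc₂ hc₂'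
    hc₃ hc₃' hc₄ hc₄' h₁₂ h₁₂' h₂₃ h₂₃' f₁₃ f₂₄ f₃₄ f₄₁
  simp only [dist_eq_norm] at *
  have ha : p - c ≠ 0 := by
    intro h
    rw [norm_sub_rev, h, norm_zero] at hcp
    linarith
  obtain ⟨x, y, ρ, α, hα, hρ0, hρ, hxy, hid⟩ := link_frame (p - c) ha
  have P₁ := link_vpoint hα hρ0 hρ hη0 hη hcp hcp' hp₁ hp₁' hc₁ hc₁'
  have P₂ := link_vpoint hα hρ0 hρ hη0 hη hcp hcp' hp₂ hp₂' hc₂ hc₂'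
  have P₃ := link_vpoint hα hρ0 hρ hη0 hη hcp hcp' hp₃ hp₃' hc₃ hc₃'
  have P₄ := link_vpoint hα hρ0 hρ hη0 hη hcp hcp' hp₄ hp₄' hc₄ hc₄'
  obtain ⟨c₁₂, c₁₂'⟩ := link_vcontact hid P₁ P₂ hη0 hη h₁₂ h₁₂'
  obtain ⟨c₂₃, c₂₃'⟩ := link_vcontact hid P₂ P₃ hη0 hη h₂₃ h₂₃'
  obtain ⟨e₁₃, e₂₄⟩ := link_planarB (hxy _ P₁.2.2.2.2.1) (hxy _ P₂.2.2.2.2.1)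
    (hxy _ P₃.2.2.2.2.1) (hxy _ P₄.2.2.2.2.1) c₁₂ c₁₂' c₂₃ c₂₃' (link_vfar hid P₁ P₃ f₁₃)
    (link_vfar hid P₂ P₄ f₂₄) (link_vfar hid P₃ P₄ f₃₄) (link_vfar hid P₄ P₁ f₄₁)
  exact ⟨link_vback hid P₁ P₃ (by norm_num) (by norm_num) e₁₃,
    link_vback hid P₂ P₄ (by norm_num) (by norm_num) e₂₄⟩

/-- **The link lemma** (registered stub `stub_linkLemma` of the birth line, verbatim): the
conjunction of `link_typeA` and `link_typeB`. [folklore] -/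
theorem stub_linkLemma : (∀ (η : ℝ) (p c n₁ n₂ n₃ n₄ : EuclideanSpace ℝ (Fin 3)), 0 ≤ η → η ≤ 1 / 1000 → 1 - η ≤ dist c p → dist c p ≤ 1 + η → 1 - η ≤ dist p n₁ → dist p n₁ ≤ 1 + η → 1 - η ≤ dist p n₂ → dist p n₂ ≤ 1 + η → 1 - η ≤ dist p n₃ → dist p n₃ ≤ 1 + η → 1 - η ≤ dist p n₄ → dist p n₄ ≤ 1 + η → 1 - η ≤ dist c n₁ → dist c n₁ ≤ 1 + η → 1 - η ≤ dist c n₂ → dist c n₂ ≤ 1 + η → 1 - η ≤ dist c n₃ → dist c n₃ ≤ 1 + η → 1 - η ≤ dist c n₄ → dist c n₄ ≤ 1 + η → 1 - η ≤ dist n₁ n₂ → dist n₁ n₂ ≤ 1 + η → 1 - η ≤ dist n₃ n₄ → dist n₃ n₄ ≤ 1 + η → 131 / 100 ≤ dist n₁ n₃ → 131 / 100 ≤ dist n₂ n₄ → 131 / 100 ≤ dist n₂ n₃ → 131 / 100 ≤ dist n₄ n₁ → (17 / 10 ≤ dist n₁ n₃ ∧ 17 / 10 ≤ dist n₂ n₄)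 ∨ (17 / 10 ≤ dist n₂ n₃ ∧ 17 / 10 ≤ dist n₄ n₁)) ∧ (∀ (η : ℝ) (p c n₁ n₂ n₃ n₄ : EuclideanSpace ℝ (Fin 3)), 0 ≤ η → η ≤ 1 / 1000 → 1 - η ≤ dist c p → dist c p ≤ 1 + η → 1 - η ≤ dist p n₁ → dist p n₁ ≤ 1 + η → 1 - η ≤ dist p n₂ → dist p n₂ ≤ 1 + η → 1 - η ≤ dist p n₃ → dist p n₃ ≤ 1 + η → 1 - η ≤ dist p n₄ → dist p n₄ ≤ 1 + η → 1 - η ≤ dist c n₁ → dist c n₁ ≤ 1 + η → 1 - η ≤ dist c n₂ → dist c n₂ ≤ 1 + η → 1 - η ≤ dist c n₃ → dist c n₃ ≤ 1 + η → 1 - η ≤ dist c n₄ → dist c n₄ ≤ 1 + η → 1 - η ≤ dist n₁ n₂ → dist n₁ n₂ ≤ 1 + η → 1 - η ≤ dist n₂ n₃ → dist n₂ n₃ ≤ 1 + η → 131 / 100 ≤ dist n₁ n₃ → 131 / 100 ≤ dist n₂ n₄ → 131 / 100 ≤ dist n₃ n₄ → 131 / 100 ≤ dist n₄ n₁ → 8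 / 5 ≤ dist n₁ n₃ ∧ 17 / 10 ≤ dist n₂ n₄) :=
  ⟨link_typeA, link_typeB⟩

end Summit.AtomisticToContinuum.Crystallization.Theorems.ZeroDefectDensityBirth
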